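import Summits.QuantumFields.YangMills.Theorems.UnitScaleTiltProp7CombChartFlatPureGauge
import Summits.QuantumFields.YangMills.Theorems.UnitScaleTiltProp7SymAvgTwSymDefs
import Literature.MathematicalPhysics.QuantumFieldTheory.Balaban1983to89.B5Eq120IterProof
import Literature.MathematicalPhysics.QuantumFieldTheory.Balaban1983to89.B6SectAOntoV1
import HarnessLib

/-!
# `UnitScaleTiltProp7CombBoxBlockDictionary` — THE `ℤᵈ`-BOX ∕ T³-BLOCK DICTIONARY AT THE ROUTE'S BASE POINT: the iterated `ℤᵈ` box mean of a based pullback, read at the canonical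
# coordinates of a comparison site, IS the T³ iterated block mean of the parameter TRANSLATED BY THE BASE POINT'S LABEL VECTOR; hence
# **`QTw 1 (D(1)λ)(c) = S(ĉ₊) − S(ĉ₋)`, `S := siteAvgIter (K−n) (−λ ∘ t_{x₀})`** against **`QTwS 1 (D(1)λ)(c) = S₀(ĉ₋) − S₀(ĉ₊)`, `S₀ := siteAvgIter (K−n) λ`** — the comb and S
# linearised averages see the SAME block-mean functional on gauge directions, up to the lattice translation `t_{x₀}` by the base point `x₀ = embIter (K−n) 0` (label `(L^{K−n}−1)∕2` per axis:
# HALF A BLOCK) — ★★OWNER ym3-torus-plan g29 RULING №18's identification «`N_c(1) = τ·N_S(1)`» at the level of the averaging letters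
(route `UnitScaleTilt`, crux K1 «MinimiserStabilityRegPr» stmt-QuantumFields-19200; RULING №17 (2) «COMB-FLAT COERCIVITY» ∕ №18 «HALF-BLOCK OFFSET — keep `basePt`, identify by τ»; item (b2) of
px6 g5's LOCATE `LOCATE-COMBFLAT-px6g5.md` ADDENDUM (F*); def-free, count-neutral).
Cell `ym3-torus` (HUMAN RULING D-0037, YM ladder rung R3 — YM₃ on T³ is a rung, not d = 4, not a mass gap, not Clay), width seat `ym3-torus-px6` (gen 5).

WHAT IS PROVED (sorry-free, no definition; `labels w := (μ ↦ ((w μ).val : ℤ))`, `t_{x} y := transl y (labels x)`):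
* §1 ★★★ **`qpIter_one_transl_eq_siteAvgIter`** — for every torus `P`, base point `x₀ ∈ T^{(0)}`, parameter `λ : T^{(0)} → 𝔸`, level `j ≤ m + K` and site `w ∈ T^{(j)}`:
  `QpIter L 1 (λ ∘ transl x₀) j (labels w) = siteAvgIter j (λ ∘ t_{x₀}) w` — induction on `j`: the `ℤᵈ` step reads the box `L·z + [0,L)ᵈ` (lit `B9Eq3114Proof.P12.Qp` with trivial transporters),
  the T³ step the block `blockSite w r` of labels `L·w + r` (lit `TorusGeometry.Site.val_blockSite`), and `transl x₀ (labels w) = t_{x₀} w` (commutativity of label addition).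
* §2 ★★★ **`QTw_one_gaugeDir_siteAvgIter`** — `QTw F n K h 1 (b ↦ λ(b₋) − λ(b₊)) = c ↦ S(ŷc₊) − S(ŷc₋)`, `S = siteAvgIter (K−n) (x ↦ −λ(t_{x₀} x))`, `ŷ = siteShift` (✓`Prop7CombChartFlatPureGauge.QTw_one_gaugeDir`
  ∘ §1; the differentiability row `hQ` is ✓`Prop7CombChartFlatPureGauge.differentiableAt_logChartTw_one` (v1.1 ✓p696244), kept as an argument here only because the farm's tree
  had not yet rebuilt that module when §2 was first checked; `QTw_one_gaugeDir_siteAvgIter'` is the unconditional form); ★ **`QTwS_one_gaugeDir_siteAvgIter`** — `QTwS F n K h 1 (b ↦ λ(b₋) − λ(b₊)) = c ↦ S₀(ŷc₋) − S₀(ŷc₊)`, `S₀ = siteAvgIter (K−n) λ` (✓`Prop7SymAvgTwSymDefs.QTwS_one_apply` ∘ lit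
  ✓`B5Eq120IterProof.bondAvgIter_grad`).  So on gauge directions the two letters differ EXACTLY by `λ ↦ λ ∘ t_{x₀}` (and a sign convention absorbed in `S`): the kernels are translates,
  `N_c(1) = t_{x₀}·N_S(1)` at the level of parameters — RULING №18 (2); §3 ★★★ **`QTw_one_gaugeDir_eq_QTwS_transl`**: `QTw 1 (D(1)λ) = QTwS 1 (D(1)(λ ∘ t_{x₀}))` EXACTLY.
HONEST FRAMING.  The Hilbert-letter translation `τ` (unitary on `SiteL2K ∕ BondL2K`, commuting with `Δ^η(1)`, `D(1)`) and `Rc 1 = τ RS 1 τ⁻¹` (item (b1)) are NOT here; nothing of COMB-FLAT COERCIVITY's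
content (I3′), of HESS ∕ E′ ∕ EX ∕ the crux K1 is proved; rung R3, not Clay; YM gap NOT proved.  `--supports stmt-QuantumFields-19200 --as helper`.
References: T. Bałaban, CMP 99 (1985) 389–434 [Balaban1985BackgroundPropagators] ((3.19) p.393, (3.115) p.418); CMP 95 (1984) 17–40 [Balaban1984PropagatorsI] ((1.13), (1.20) pp.19–20);
CMP 109 (1987) 249–301 [Balaban1987RG1] ((0.1) p.251).
-/

noncomputable section

open scoped Matrix.Norms.L2Operator Topology

namespace Summit.QuantumFields.YangMills.Theorems.Prop7CombBoxBlockDictionary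

open Literature.MathematicalPhysics.QuantumFieldTheory.Balaban1983to89
open Literature.MathematicalPhysics.QuantumFieldTheory.Balaban1983to89.T3ContinuumYM3Torus
open T3LevelShift (siteShift bondShift bondShift_tgt)
open T3PrintedRegularOrbits (sites_eq)
open LatticeFieldCalculus (siteAvg siteAvgIter bondAvgIter grad)
open B5Eq120IterProof (siteAvgIter_zero siteAvgIter_succ bondAvgIter_grad)
open B7Prop2Explicit (avgIter)
open B7Eq92Concrete (avgIter_one)
open B7Eq78Linearization (conjR conjR_apply)
open B8Ineq130 (hol_one)
open B10Eq27TorusAxialLog (transl transl_apply)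
open B9Eq3114Proof.P12 (QpIter QpIter_zero QpIter_succ Qp)
open Summit.QuantumFields.YangMills.Theorems.Prop7SPrint (basePt)
open Summit.QuantumFields.YangMills.Theorems.Prop7SymAvgTw (coordT3 coordT3_apply logChartTw QTw)
open Summit.QuantumFields.YangMills.Theorems.Prop7SymAvgTwSym (QTwS QTwS_one_apply)
open Summit.QuantumFields.YangMills.Theorems.Prop7CombChartFlatPureGauge (QTw_one_gaugeDir differentiableAt_logChartTw_one)

/-! ## §1 The dictionary: `ℤᵈ` box means of a based pullback = T³ block means of the translated parameter -/

section Dictionary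

variable {P : Params} {𝔸 : Type*} [NormedRing 𝔸] [NormedAlgebra ℂ 𝔸] [CompleteSpace 𝔸]

/-- label addition commutes: `transl x₀ (labels w) = transl w (labels x₀)` (both are `x₀ + w` coordinatewise in `ZMod`). [cite: Balaban1987RG1, (0.1) p.251] -/
theorem transl_labels_comm (x₀ w : Site P 0) :
    transl x₀ (fun μ => (((w μ).val : ℕ) : ℤ)) = transl w (fun μ => (((x₀ μ).val : ℕ) : ℤ)) := by
  funext ν
  rw [transl_apply, transl_apply, Int.cast_natCast, Int.cast_natCast, ZMod.natCast_zmod_val, ZMod.natCast_zmod_val, add_comm]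

/-- the labels of a block site: `labels (blockSite w r) = L·labels w + r` (lit ✓`Site.val_blockSite`, standing range). [cite: Balaban1987RG1, (0.1) p.251] -/
theorem labels_blockSite {j : ℕ} (hj : j + 1 ≤ P.m + P.K) (w : Site P (j + 1)) (r : Fin P.d → Fin P.L) :
    (fun μ => ((((Site.blockSite w r) μ).val : ℕ) : ℤ)) = (P.L : ℤ) • (fun μ => (((w μ).val : ℕ) : ℤ)) + B7Prop1Explicit.boxVec P.L r := by
  funext μ
  rw [Site.val_blockSite hj, Pi.add_apply, Pi.smul_apply, smul_eq_mul]
  simp only [B7Prop1Explicit.boxVec]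
  push_cast
  ring

/-- ★★★ **THE `ℤᵈ`-BOX ∕ T³-BLOCK DICTIONARY**: `QpIter L 1 (λ ∘ transl x₀) j (labels w) = siteAvgIter j (λ ∘ t_{x₀}) w` for `j ≤ m + K` — the iterated box mean (3.19) with trivial transporters of the
based pullback of `λ`, read at the labels of `w ∈ T^{(j)}`, is the iterated T³ block mean (1.20) of `x ↦ λ(transl x (labels x₀))` at `w`.
[cite: Balaban1985BackgroundPropagators, (3.19) p.393; Balaban1984PropagatorsI, (1.20) p.20; Balaban1987RG1, (0.1) p.251] -/
theorem qpIter_one_transl_eq_siteAvgIter (x₀ : Site P 0) (lam : Site P 0 → 𝔸) :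
    ∀ (j : ℕ), j ≤ P.m + P.K → ∀ w : Site P j,
      QpIter P.L (1 : B7Prop1Explicit.Site P.d → Fin P.d → 𝔸ˣ) (fun z => lam (transl x₀ z)) j (fun μ => (((w μ).val : ℕ) : ℤ))
        = siteAvgIter j (fun x => lam (transl x (fun μ => (((x₀ μ).val : ℕ) : ℤ)))) w
  | 0, _, w => by
    rw [QpIter_zero, siteAvgIter_zero, transl_labels_comm]
  | j + 1, hj, w => by
    rw [QpIter_succ, avgIter_one, siteAvgIter_succ]
    unfold Qp siteAvg
    rw [Finset.smul_sum]
    refine Finset.sum_congr rfl fun r _ => ?_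
    rw [hol_one, show conjR (1 : 𝔸ˣ) = id from funext fun Y => by simp [conjR_apply], id,
      ← labels_blockSite hj w r, qpIter_one_transl_eq_siteAvgIter x₀ lam j (by omega) (Site.blockSite w r)]

end Dictionary

/-! ## §2 At the route: `QTw 1` and `QTwS 1` on gauge directions, both in T³ block-mean letters -/

section Route

variable (F : T3Family) {n K : ℕ} (h : n ≤ K)

/-- ★★★ **`QTw 1 (D(1)λ)(c) = S(ŷc₊) − S(ŷc₋)`, `S := siteAvgIter (K−n) (x ↦ −λ(transl x (labels x₀)))`** — ✓`QTw_one_gaugeDir` through the dictionary §1 (`hQ` := ✓`differentiableAt_logChartTw_one`) (`coordT3 = labels ∘ siteShift`): the comb letter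
on gauge directions is the coarse gradient of the T³ block mean of the parameter TRANSLATED by the base point's labels (half a block per axis).
[cite: Balaban1985BackgroundPropagators, (3.115) p.418, (3.19) p.393; Balaban1984PropagatorsI, (1.20) p.20] -/
theorem QTw_one_gaugeDir_siteAvgIter (hQ : DifferentiableAt ℂ (logChartTw F n K h (1 : GaugeField (F.P K) 0 (Matrix.specialUnitaryGroup (Fin 2) ℂ))) 0)
    (lam : Site (F.P K) 0 → Matrix (Fin 2) (Fin 2) ℂ) :
    QTw F n K h (1 : GaugeField (F.P K) 0 (Matrix.specialUnitaryGroup (Fin 2) ℂ)) (fun b : PBond (F.P K) 0 => lam b.src - lam b.tgt)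
      = fun c : PBond (F.P n) 0 =>
          siteAvgIter (K - n) (fun x : Site (F.P K) 0 => -lam (transl x (fun μ => (((basePt F n K μ).val : ℕ) : ℤ)))) (siteShift (sites_eq F n K h) c.tgt)
            - siteAvgIter (K - n) (fun x : Site (F.P K) 0 => -lam (transl x (fun μ => (((basePt F n K μ).val : ℕ) : ℤ)))) (siteShift (sites_eq F n K h) c.src) := by
  rw [QTw_one_gaugeDir hQ]
  funext c
  have hk : K - n ≤ (F.P K).m + (F.P K).K := by show K - n ≤ F.m + K; omega
  have h1 := qpIter_one_transl_eq_siteAvgIter (basePt F n K) (fun x => -lam x) (K - n) hk (siteShift (sites_eq F n K h) c.tgt)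
  have h2 := qpIter_one_transl_eq_siteAvgIter (basePt F n K) (fun x => -lam x) (K - n) hk (siteShift (sites_eq F n K h) c.src)
  exact congrArg₂ (fun a b : Matrix (Fin 2) (Fin 2) ℂ => a - b) h1 h2

/-- ★★★ **The same, UNCONDITIONAL** (`hQ` := ✓`Prop7CombChartFlatPureGauge.differentiableAt_logChartTw_one`): `QTw 1 (D(1)λ)(c) = S(ŷc₊) − S(ŷc₋)`, `S := siteAvgIter (K−n) (−λ ∘ t_{x₀})`.
[cite: Balaban1985BackgroundPropagators, (3.115) p.418; Balaban1984PropagatorsI, (1.20) p.20] -/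
theorem QTw_one_gaugeDir_siteAvgIter' (lam : Site (F.P K) 0 → Matrix (Fin 2) (Fin 2) ℂ) :
    QTw F n K h (1 : GaugeField (F.P K) 0 (Matrix.specialUnitaryGroup (Fin 2) ℂ)) (fun b : PBond (F.P K) 0 => lam b.src - lam b.tgt)
      = fun c : PBond (F.P n) 0 =>
          siteAvgIter (K - n) (fun x : Site (F.P K) 0 => -lam (transl x (fun μ => (((basePt F n K μ).val : ℕ) : ℤ)))) (siteShift (sites_eq F n K h) c.tgt)
            - siteAvgIter (K - n) (fun x : Site (F.P K) 0 => -lam (transl x (fun μ => (((basePt F n K μ).val : ℕ) : ℤ)))) (siteShift (sites_eq F n K h) c.src) :=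
  QTw_one_gaugeDir_siteAvgIter F h (differentiableAt_logChartTw_one (F := F) (h := h)) lam

/-- ★ **`QTwS 1 (D(1)λ)(c) = S₀(ŷc₋) − S₀(ŷc₊)`, `S₀ := siteAvgIter (K−n) λ`** — ✓`QTwS_one_apply` (`QTwS 1 = L^{K−n}•tube`) with lit ✓`bondAvgIter_grad` (`Q_k∂ = ∂Q′_k`): the S letter on gauge
directions is the coarse gradient of the UNTRANSLATED block mean. [cite: Balaban1984PropagatorsI, (1.13) p.19, (1.20) p.20; Balaban1985Averaging, (125) p.36] -/
theorem QTwS_one_gaugeDir_siteAvgIter (lam : Site (F.P K) 0 → Matrix (Fin 2) (Fin 2) ℂ) :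
    QTwS F n K h (1 : GaugeField (F.P K) 0 (Matrix.specialUnitaryGroup (Fin 2) ℂ)) (fun b : PBond (F.P K) 0 => lam b.src - lam b.tgt)
      = fun c : PBond (F.P n) 0 =>
          siteAvgIter (K - n) lam (siteShift (sites_eq F n K h) c.src) - siteAvgIter (K - n) lam (siteShift (sites_eq F n K h) c.tgt) := by
  funext c
  have hk : K - n ≤ (F.P K).m + (F.P K).K := by show K - n ≤ F.m + K; omega
  have hgrad : (fun b : PBond (F.P K) 0 => lam b.src - lam b.tgt) = grad (-1) lam := by
    funext b; simp only [grad, neg_one_smul, neg_sub]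
  have hsrc : (bondShift (sites_eq F n K h) c).src = siteShift (sites_eq F n K h) c.src := rfl
  have htgt : (bondShift (sites_eq F n K h) c).tgt = siteShift (sites_eq F n K h) c.tgt := bondShift_tgt _ _
  have hLc : (((F.P K).L : ℕ) : ℂ) ≠ 0 := Nat.cast_ne_zero.2 (F.P K).L_pos.ne'
  -- `L^k • ((−1∕L^k) • (X − Y)) = Y − X`, entrywise
  have key : ∀ X Y : Matrix (Fin 2) (Fin 2) ℂ,
      ((((F.P K).L : ℕ) : ℂ) ^ (K - n)) • ((-1 / ((F.P K).L : ℝ) ^ (K - n)) • (X - Y)) = Y - X := by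
    intro X Y
    ext i j
    simp only [Matrix.smul_apply, Matrix.sub_apply, Complex.real_smul, smul_eq_mul]
    push_cast
    field_simp
    ring
  rw [QTwS_one_apply, hgrad, bondAvgIter_grad (K - n) hk]
  simp only [grad]
  rw [key]
  exact congrArg₂ (fun a b => siteAvgIter (K - n) lam a - siteAvgIter (K - n) lam b) hsrc htgt

/-! ### §3 RULING №18's identification at the letter level: the comb letter on a gauge direction IS the S letter on the TRANSLATED gauge direction -/

/-- block means commute with negation (lit `B6SectAOntoV1.siteAvgIterLin` is linear). [cite: Balaban1984PropagatorsI, (1.20) p.20] -/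
theorem siteAvgIter_neg (k : ℕ) (f : Site (F.P K) 0 → Matrix (Fin 2) (Fin 2) ℂ) :
    siteAvgIter k (fun x => -f x) = fun y => -siteAvgIter k f y := by
  have hmap := (B6SectAOntoV1.siteAvgIterLin (F.P K) (Matrix (Fin 2) (Fin 2) ℂ) k).map_neg f
  simp only [B6SectAOntoV1.siteAvgIterLin_apply] at hmap
  exact hmap

/-- ★★★ **`QTw 1 (D(1)λ) = QTwS 1 (D(1)(λ ∘ t_{x₀}))`** — at the flat member the route's comb linearised average of the gauge direction of `λ` EQUALS the symmetric one of the gauge direction of the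
TRANSLATED parameter `λ ∘ t_{x₀}`, `t_{x₀} x = transl x (labels x₀)` (half a block per axis): ★★OWNER RULING №18 (2) «`N_c(1) = τ·N_S(1)`» at the level of the averaging letters, by kernel
(§2 twice and `(−a) − (−b) = b − a`).  The Hilbert-letter form `Rc 1 = τ RS 1 τ⁻¹` (item (b1)) is the transport of this identity through `toL2S ∕ toL2B` and `projR`.
[cite: Balaban1985BackgroundPropagators, (3.115) p.418, (3.19)–(3.21) pp.393–394; Balaban1984PropagatorsI, (1.20) p.20] -/
theorem QTw_one_gaugeDir_eq_QTwS_transl (lam : Site (F.P K) 0 → Matrix (Fin 2) (Fin 2) ℂ) :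
    QTw F n K h (1 : GaugeField (F.P K) 0 (Matrix.specialUnitaryGroup (Fin 2) ℂ)) (fun b : PBond (F.P K) 0 => lam b.src - lam b.tgt)
      = QTwS F n K h (1 : GaugeField (F.P K) 0 (Matrix.specialUnitaryGroup (Fin 2) ℂ)) (fun b : PBond (F.P K) 0 =>
          lam (transl b.src (fun μ => (((basePt F n K μ).val : ℕ) : ℤ))) - lam (transl b.tgt (fun μ => (((basePt F n K μ).val : ℕ) : ℤ)))) := by
  rw [QTw_one_gaugeDir_siteAvgIter' F h lam,
    QTwS_one_gaugeDir_siteAvgIter F h (fun x : Site (F.P K) 0 => lam (transl x (fun μ => (((basePt F n K μ).val : ℕ) : ℤ)))),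
    siteAvgIter_neg]
  funext c
  exact neg_sub_neg _ _

end Route

end Summit.QuantumFields.YangMills.Theorems.Prop7CombBoxBlockDictionary

end
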